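import Mathlib.NumberTheory.NumberField.AdeleRing
import Mathlib.NumberTheory.NumberField.ProductFormula
import Mathlib.NumberTheory.NumberField.Completion.FinitePlace
import Mathlib.Topology.Algebra.Group.Quotient
import Mathlib.Topology.Algebra.ContinuousMonoidHom
import Literature.NumberTheory.GaloisRepresentations.HeckeCharacter
import Literature.NumberTheory.Automorphic.AdelicGroupData
import HarnessLib

-- D-0014 sorry-sweep (operator, 2026-08-13): sorried theorems -> named facts `def X : Prop`; partial proofs preserved in comments
-- provenance: harness21/H21/H21/Prelude/AutomorphicAxiomatic/IdeleClassGroup.lean @ eecc4ae (interim HEAD d8f2665); M5 mechanical rewrite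
/-!
# The idele class group `C_K = 𝕀_K / Kˣ`

Trunk `AutomorphicAxiomatic` (G19), item C1 `IdeleClassGroup` (notion `idele_class_group`).

Let `K` be a number field, `𝕀_K = 𝔸_Kˣ` its idele group (`Literature.ideleGroup K`, from
`Literature.Prelude.GalRep.HeckeCharacter`, together with the principal ideles
`Literature.principalIdeles K = Kˣ`).  This file provides

* the **idelic norm** as an honest monoid homomorphism `ideleNorm K : 𝕀_K →* ℝ≥0`,
  `‖x‖ = ∏_{w ∣ ∞} ‖x_w‖^{[K_w : ℝ]} · ∏_{v ∤ ∞} ‖x_v‖_v` (the finite part is a `finprod`; the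
  proof that all but finitely many factors are `1` uses Mathlib's
  `FiniteAdeleRing.unitsEquiv_finite_valued_eq_one` and `FinitePlace.norm_def`), its
  units-valued form `ideleNormUnits K : 𝕀_K →* ℝ≥0ˣ` (`MonoidHom.toHomUnits`), and the
  norm-one ideles `normOneIdeles K = 𝕀_K¹`;
* the **idele class group** `IdeleClassGroup K := 𝕀_K ⧸ Kˣ` with Mathlib's quotient topology
  (a topological group), its subgroups `IdeleClassGroup.normOne K = C_K¹`,
  `IdeleClassGroup.posReal K` (image of `ℝ_{>0}` via `posRealIdele`, from `AdelicGroupData`) and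
  `IdeleClassGroup.identityComponent K = D_K`;
* the classical structure theorems (proofs `sorry`): compactness of `C_K¹`, `C_K = C_K¹ × ℝ_{>0}`,
  Hausdorffness, `automorphicQuotient (gl1 K) ≃ₜ C_K¹`;
* the reconciliation with G09: `HeckeCharacter K ≃ (IdeleClassGroup K →ₜ* ℂˣ)` (real).

## Mathlib search

Mathlib (this pin) has the adele ring `NumberField.AdeleRing (𝓞 K) K = K_∞ × 𝔸_K^∞`, a `Norm`
instance on `InfiniteAdeleRing K` (`InfiniteAdeleRing.norm_def : ‖x‖ = ∏ v, ‖x v‖ ^ v.mult`, which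
is our archimedean factor, see `coe_ideleNorm`), the product formula `NumberField.prod_abs_eq_one`,
`FiniteAdeleRing.isUnit_iff / unitsEquiv_finite_valued_eq_one`, `QuotientGroup` topology
instances, `Subgroup.connectedComponentOfOne`, `MonoidHom.toHomUnits`, and the `ℝ≥0`-valued
character precedent `MeasureTheory.Measure.modularCharacter`; but no idele norm, idele class
group or norm-one ideles (grep `idele`, `IdeleClass`, `normOne`: nothing).  G09's real-valued
function `Literature.ideleNorm : 𝕀_K → ℝ` is the coercion of ours (`coe_ideleNorm`).  Wave0's ad-hoc
`Literature.NumberTheory.Automorphic.LangWave0.IdeleClassGroup` is superseded by this file.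

## Design

* `K : Type` (universe `0`), because `Automorphic.posRealIdele` and `AdelicGroupData.gl1` are
  universe-`0` (outline C9).
* Generic names live in `namespace Literature.Automorphic` (outline, review F2); the two dot-notation
  declarations `HeckeCharacter.toIdeleClassCharacter/equivIdeleClassCharacter` live in
  `namespace Literature.HeckeCharacter` (G09's structure) so that dot notation works.

## References

* J. W. S. Cassels, A. Fröhlich (eds.), *Algebraic Number Theory* (1967), Ch. II (Cassels,
  *Global fields*) §§16–18; Ch. XV (Tate's thesis) §4.
* A. Weil, *Basic Number Theory* (1967), Ch. IV §4.
* J. Neukirch, *Algebraic Number Theory*, Ch. VI §1.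
-/

noncomputable section

open scoped NNReal
open NumberField IsDedekindDomain Topology

namespace Literature.NumberTheory.Automorphic

variable (K : Type) [Field K] [NumberField K]

/-! ### The idelic norm -/

variable {K} in
/-- Archimedean components of a product of ideles multiply componentwise (definitional). [folklore] -/
theorem ideleGroup_fst_mul_apply (x y : GaloisRepresentations.ideleGroup K) (w : InfinitePlace K) :
    ((x * y : GaloisRepresentations.ideleGroup K) : AdeleRing (𝓞 K) K).1 w =
      (x : AdeleRing (𝓞 K) K).1 w * (y : AdeleRing (𝓞 K) K).1 w := rfl

variable {K} in
/-- Finite components of a product of ideles multiply componentwise (definitional). [folklore] -/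
theorem ideleGroup_snd_mul_apply (x y : GaloisRepresentations.ideleGroup K) (v : HeightOneSpectrum (𝓞 K)) :
    ((x * y : GaloisRepresentations.ideleGroup K) : AdeleRing (𝓞 K) K).2 v =
      (x : AdeleRing (𝓞 K) K).2 v * (y : AdeleRing (𝓞 K) K).2 v := rfl

/-- Archimedean components of the idele `1` are `1` (definitional). [folklore] -/
theorem ideleGroup_fst_one_apply (w : InfinitePlace K) :
    ((1 : GaloisRepresentations.ideleGroup K) : AdeleRing (𝓞 K) K).1 w = 1 := rfl

/-- Finite components of the idele `1` are `1` (definitional). [folklore] -/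
theorem ideleGroup_snd_one_apply (v : HeightOneSpectrum (𝓞 K)) :
    ((1 : GaloisRepresentations.ideleGroup K) : AdeleRing (𝓞 K) K).2 v = 1 := rfl

/-- An idele has local norm `‖x_v‖_v = 1` at all but finitely many finite places `v` (its finite
part is a unit of the restricted product, Mathlib `FiniteAdeleRing.unitsEquiv_finite_valued_eq_one`).
Ref: Cassels–Fröhlich, Ch. II §16 (definition of ideles). [folklore] -/
theorem hasFiniteMulSupport_nnnorm (x : GaloisRepresentations.ideleGroup K) :
    (fun v : HeightOneSpectrum (𝓞 K) => ‖(x : AdeleRing (𝓞 K) K).2 v‖₊).HasFiniteMulSupport := by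
  have h := FiniteAdeleRing.unitsEquiv_finite_valued_eq_one
    (Units.map (RingHom.snd (InfiniteAdeleRing K) (FiniteAdeleRing (𝓞 K) K) :
      AdeleRing (𝓞 K) K →+* FiniteAdeleRing (𝓞 K) K).toMonoidHom x)
  refine Set.Finite.subset (Filter.eventually_cofinite.mp h) fun v hv => ?_
  intro hv1
  apply hv
  apply NNReal.eq
  change ‖(x : AdeleRing (𝓞 K) K).2 v‖ = 1
  rw [FinitePlace.norm_def, show Valued.v ((x : AdeleRing (𝓞 K) K).2 v) = 1 from hv1, map_one, NNReal.coe_one]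

/-- The **idelic norm** (module, content) `‖·‖ : 𝕀_K →* ℝ≥0`,
`‖x‖ = ∏_{w ∣ ∞} ‖x_w‖^{mult w} · ∏_{v ∤ ∞} ‖x_v‖_v`, with Mathlib's normalised absolute values
(`mult w = [K_w : ℝ]`, `‖ϖ_v‖_v = (N v)⁻¹`), as an honest monoid homomorphism.  The finite part is
a `finprod`, all but finitely many factors being `1` (`hasFiniteMulSupport_nnnorm`).
Ref: Cassels–Fröhlich, Ch. II §16; Weil, *Basic Number Theory*, Ch. IV §4; Mathlib precedent
for `ℝ≥0`-valued characters: `MeasureTheory.Measure.modularCharacter`. [folklore] -/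
def IdeleClassGroup.ideleNorm : GaloisRepresentations.ideleGroup K →* ℝ≥0 where
  toFun x := (∏ w : InfinitePlace K, ‖(x : AdeleRing (𝓞 K) K).1 w‖₊ ^ w.mult) *
    ∏ᶠ v : HeightOneSpectrum (𝓞 K), ‖(x : AdeleRing (𝓞 K) K).2 v‖₊
  map_one' := by
    simp only [ideleGroup_fst_one_apply, ideleGroup_snd_one_apply, nnnorm_one, one_pow,
      Finset.prod_const_one, finprod_one, mul_one]
  map_mul' x y := by
    simp only [ideleGroup_fst_mul_apply, ideleGroup_snd_mul_apply, nnnorm_mul, mul_pow,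
      Finset.prod_mul_distrib]
    rw [finprod_mul_distrib (hasFiniteMulSupport_nnnorm K x) (hasFiniteMulSupport_nnnorm K y)]
    ring

/-- Unfolding the idelic norm.  Ref: Cassels–Fröhlich, Ch. II §16. [folklore] -/
@[simp]
theorem ideleNorm_apply (x : GaloisRepresentations.ideleGroup K) :
    IdeleClassGroup.ideleNorm K x = (∏ w : InfinitePlace K, ‖(x : AdeleRing (𝓞 K) K).1 w‖₊ ^ w.mult) *
      ∏ᶠ v : HeightOneSpectrum (𝓞 K), ‖(x : AdeleRing (𝓞 K) K).2 v‖₊ := rfl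

/-- The idelic norm, coerced to `ℝ`, is Mathlib's norm of the archimedean component
(`InfiniteAdeleRing.norm_def`) times the finite product of the local norms; in particular it is
G09's real-valued `Literature.NumberTheory.GaloisRepresentations.ideleNorm`.  Ref: Cassels–Fröhlich, Ch. II §16. [folklore] -/
theorem coe_ideleNorm (x : GaloisRepresentations.ideleGroup K) :
    (IdeleClassGroup.ideleNorm K x : ℝ) = Literature.NumberTheory.GaloisRepresentations.ideleNorm x := by
  simp only [ideleNorm_apply, Literature.NumberTheory.GaloisRepresentations.ideleNorm, NNReal.coe_mul, NNReal.coe_prod, NNReal.coe_pow,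
    coe_nnnorm]
  congr 1
  exact (NNReal.toRealHom.map_finprod_of_injective NNReal.coe_injective _).trans rfl

/-- The idelic norm with values in the group `ℝ_{>0} = ℝ≥0ˣ` (Mathlib `MonoidHom.toHomUnits`);
used for the splitting `C_K ≅ C_K¹ × ℝ_{>0}`.  Ref: Weil, *Basic Number Theory*, Ch. IV §4. [folklore] -/
def ideleNormUnits : GaloisRepresentations.ideleGroup K →* ℝ≥0ˣ := (IdeleClassGroup.ideleNorm K).toHomUnits

/-- `ideleNormUnits` is `ideleNorm` (definitional). [folklore] -/
@[simp]
theorem coe_ideleNormUnits (x : GaloisRepresentations.ideleGroup K) : (ideleNormUnits K x : ℝ≥0) = IdeleClassGroup.ideleNorm K x := rfl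

/-- The idelic norm is continuous on `𝕀_K` (units topology).
Ref: Cassels–Fröhlich, Ch. II §16 (continuity of the content); Weil, *Basic Number Theory*,
Ch. IV §4 (the module `|z|_𝔸`). [cite: WeilBNT1967, Ch. IV §4 (module of an idele)] -/
def continuous_ideleNorm : Prop :=
  Continuous (IdeleClassGroup.ideleNorm K)

/-- The idelic norm `𝕀_K → ℝ_{>0}` is surjective (already on the image of `ℝ_{>0}`,
`ideleNorm_posRealIdele`).  Ref: Weil, *Basic Number Theory*, Ch. IV §4, Cor. 3 of Thm 6
(number field case). [cite: WeilBNT1967, Ch. IV §4 Cor. 3 of Thm. 6] -/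
def ideleNormUnits_surjective : Prop :=
  Function.Surjective (ideleNormUnits K)

variable {K} in
/-- **Product formula**: principal ideles have idelic norm `1`
(Mathlib `NumberField.prod_abs_eq_one`).  Ref: Cassels–Fröhlich, Ch. II §12, Theorem, and §16;
Weil, *Basic Number Theory*, Ch. IV §4, Thm 5. [folklore] -/
theorem ideleNorm_principal {x : GaloisRepresentations.ideleGroup K} (hx : x ∈ GaloisRepresentations.principalIdeles K) :
    IdeleClassGroup.ideleNorm K x = 1 := by
  obtain ⟨u, rfl⟩ := hx
  apply NNReal.eq
  rw [coe_ideleNorm, NNReal.coe_one]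
  have h := NumberField.prod_abs_eq_one (K := K) u.ne_zero
  rw [← finprod_comp_equiv FinitePlace.equivHeightOneSpectrum.symm] at h
  simp only [Literature.NumberTheory.GaloisRepresentations.ideleNorm]
  convert h using 2
  · refine Finset.prod_congr rfl fun w _ => ?_
    congr 1
    change ‖((u : K) : w.Completion)‖ = w u
    simpa using InfinitePlace.Completion.norm_coe (v := w) ((WithAbs.equiv w.1).symm u)
  · refine finprod_congr fun v => ?_
    rw [FinitePlace.equivHeightOneSpectrum_symm_apply]
    rfl

/-- The idelic norm of the diagonal positive real idele `r ∈ ℝ_{>0} ↪ K_∞ˣ` is `r ^ [K : ℚ]`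
(`∑_{w ∣ ∞} mult w = [K : ℚ]`, Mathlib `InfinitePlace.sum_mult_eq`).
Ref: Weil, *Basic Number Theory*, Ch. IV §4. [cite: WeilBNT1967, Ch. IV §4] -/
def ideleNorm_posRealIdele : Prop :=
  ∀ (r : ℝ≥0ˣ),
    IdeleClassGroup.ideleNorm K (posRealIdele K r) = (r : ℝ≥0) ^ Module.finrank ℚ K

/-! ### Norm-one ideles -/

/-- The **norm-one ideles** `𝕀_K¹ = ker ‖·‖`.  Ref: Cassels–Fröhlich, Ch. II §16; Weil, *Basic
Number Theory*, Ch. IV §4. [folklore] -/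
def normOneIdeles : Subgroup (GaloisRepresentations.ideleGroup K) := (IdeleClassGroup.ideleNorm K).ker

variable {K} in
/-- Membership in `𝕀_K¹`. [folklore] -/
@[simp]
theorem mem_normOneIdeles {x : GaloisRepresentations.ideleGroup K} : x ∈ normOneIdeles K ↔ IdeleClassGroup.ideleNorm K x = 1 :=
  Iff.rfl

/-- `Kˣ ⊆ 𝕀_K¹` (product formula).  Ref: Cassels–Fröhlich, Ch. II §16. [folklore] -/
theorem principalIdeles_le_normOneIdeles : GaloisRepresentations.principalIdeles K ≤ normOneIdeles K :=
  fun _ hx => ideleNorm_principal hx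

/-! ### The idele class group -/

/-- The **idele class group** `C_K = 𝕀_K ⧸ Kˣ`, with Mathlib's quotient topology (a topological
group, `QuotientGroup.instIsTopologicalGroup`).
Ref: Cassels–Fröhlich, Ch. II §16; Weil, *Basic Number Theory*, Ch. IV §4. [folklore] -/
abbrev IdeleClassGroup : Type := GaloisRepresentations.ideleGroup K ⧸ GaloisRepresentations.principalIdeles K

namespace IdeleClassGroup

/-- The quotient map `𝕀_K → C_K` as a continuous homomorphism (Mathlib `QuotientGroup.mk'`,
`QuotientGroup.continuous_mk`). [folklore] -/
def mk : GaloisRepresentations.ideleGroup K →ₜ* IdeleClassGroup K where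
  toMonoidHom := QuotientGroup.mk' (GaloisRepresentations.principalIdeles K)
  continuous_toFun := QuotientGroup.continuous_mk

/-- `mk` is the quotient map (definitional). [folklore] -/
@[simp]
theorem mk_apply (x : GaloisRepresentations.ideleGroup K) : mk K x = (x : IdeleClassGroup K) := rfl

/-- The **norm-one idele class group** `C_K¹ = 𝕀_K¹ / Kˣ`, as a subgroup of `C_K`.
Ref: Cassels–Fröhlich, Ch. II §16–17; Weil, *Basic Number Theory*, Ch. IV §4. [folklore] -/
def normOne : Subgroup (IdeleClassGroup K) :=
  (normOneIdeles K).map (QuotientGroup.mk' (GaloisRepresentations.principalIdeles K))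

/-- The image `ℝ_{>0} Kˣ / Kˣ ≅ ℝ_{>0}` in `C_K` of the diagonal archimedean positive reals
(`Automorphic.posRealIdele`), the split component of `GL₁`.
Ref: Weil, *Basic Number Theory*, Ch. IV §4 (the subgroup `M` / splitting of the module). [folklore] -/
def posReal : Subgroup (IdeleClassGroup K) :=
  (posRealIdele K).range.map (QuotientGroup.mk' (GaloisRepresentations.principalIdeles K))

/-- The **identity component** `D_K` of the idele class group (Mathlib
`Subgroup.connectedComponentOfOne`).  Ref: Weil, *Basic Number Theory*, Ch. IV §4 and Ch. XIII
§1; Artin–Tate, *Class Field Theory*, Ch. IX. [folklore] -/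
def identityComponent : Subgroup (IdeleClassGroup K) :=
  Subgroup.connectedComponentOfOne (IdeleClassGroup K)

/-- The idelic norm descends to `C_K` (product formula), `‖·‖ : C_K →* ℝ≥0`
(Mathlib `QuotientGroup.lift`).  Ref: Cassels–Fröhlich, Ch. II §16. [folklore] -/
def norm : IdeleClassGroup K →* ℝ≥0 :=
  QuotientGroup.lift (GaloisRepresentations.principalIdeles K) (ideleNorm K) (principalIdeles_le_normOneIdeles K)

/-- The class-group norm of the class of an idele is its idelic norm. [folklore] -/
@[simp]
theorem norm_mk (x : GaloisRepresentations.ideleGroup K) : norm K (x : IdeleClassGroup K) = ideleNorm K x := rfl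

variable {K} in
/-- `C_K¹` is the kernel of the norm on `C_K`. [folklore] -/
theorem mem_normOne_iff {c : IdeleClassGroup K} : c ∈ normOne K ↔ norm K c = 1 := by
  constructor
  · rintro ⟨x, hx, rfl⟩
    exact hx
  · induction c using QuotientGroup.induction_on with
    | H x => exact fun hx => ⟨x, hx, rfl⟩

/-- **Compactness of `C_K¹`** (equivalent to finiteness of the class number plus Dirichlet's
unit theorem).  Ref: Cassels–Fröhlich, Ch. II §17, Theorem; Weil, *Basic Number Theory*,
Ch. IV §4, Thm 6. [cite: WeilBNT1967, Ch. IV §4 Thm. 6] -/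
def isCompact_normOne : Prop :=
  IsCompact (normOne K : Set (IdeleClassGroup K))

/-- `Kˣ` is discrete, hence closed, in `𝕀_K`, so `C_K` is Hausdorff.
Ref: Cassels–Fröhlich, Ch. II §16, Lemma; Weil, *Basic Number Theory*, Ch. IV §4, Thm 5 ff.
[cite: CasselsFrohlichANT1967, Ch. II §16 Lemma] -/
def t2Space_ideleClassGroup : Prop :=
  T2Space (IdeleClassGroup K)

/-- The identity component `D_K` is a closed subgroup of `C_K` (connected components are closed).
Ref: Weil, *Basic Number Theory*, Ch. XIII §1. [folklore] -/
theorem isClosed_identityComponent :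
    IsClosed (identityComponent K : Set (IdeleClassGroup K)) :=
  isClosed_connectedComponent

/-- `C_K¹ ∩ ℝ_{>0} = 1` in `C_K` (the norm of `r ∈ ℝ_{>0}` is `r^{[K:ℚ]}`).
Ref: Weil, *Basic Number Theory*, Ch. IV §4, Cor. 2 of Thm 6.
[cite: WeilBNT1967, Ch. IV §4 Cor. 2 of Thm. 6] -/
def normOne_inf_posReal_eq_bot : Prop :=
  normOne K ⊓ posReal K = ⊥

/-- `C_K = C_K¹ · ℝ_{>0}`; with `normOne_inf_posReal_eq_bot`, `C_K ≅ C_K¹ × ℝ_{>0}` as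
topological groups.  Ref: Weil, *Basic Number Theory*, Ch. IV §4, Cor. 2 of Thm 6;
Cassels–Fröhlich, Ch. II §18. [cite: WeilBNT1967, Ch. IV §4 Cor. 2 of Thm. 6] -/
def normOne_sup_posReal_eq_top : Prop :=
  normOne K ⊔ posReal K = ⊤

/-- The automorphic quotient of `GL₁`, `𝕀_K ⧸ (ℝ_{>0} · Kˣ)` (`AdelicGroupData.gl1`, a
homogeneous space only), is homeomorphic to the compact group `C_K¹`
(via `C_K = C_K¹ × ℝ_{>0}`).  Ref: Weil, *Basic Number Theory*, Ch. IV §4, Cor. 2 of Thm 6.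
[cite: WeilBNT1967, Ch. IV §4 Cor. 2 of Thm. 6] -/
def nonempty_homeomorph_automorphicQuotient_normOne : Prop :=
  Nonempty ((AdelicGroupData.gl1 K).automorphicQuotient ≃ₜ normOne K)

end IdeleClassGroup

end Literature.NumberTheory.Automorphic

/-! ### Hecke characters as characters of `C_K` -/

namespace Literature.NumberTheory.Automorphic
section HeckeCharacter
open Literature.NumberTheory.GaloisRepresentations (HeckeCharacter)
open Literature.NumberTheory.GaloisRepresentations.HeckeCharacter

open IdeleClassGroup Automorphic

variable {K : Type} [Field K] [NumberField K]

/-- A Hecke character `χ : 𝕀_K →ₜ* ℂˣ`, being trivial on `Kˣ`, descends to a continuous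
quasi-character of the idele class group `C_K →ₜ* ℂˣ` (Mathlib `QuotientGroup.lift`; continuity
from `QuotientGroup.isQuotientMap_mk`).  Declared in `namespace Literature.HeckeCharacter` for dot
notation.  Ref: Cassels–Fröhlich, Ch. XV (Tate) §4.1; Weil, *Basic Number Theory*, Ch. VII §3. [folklore] -/
def _root_.Literature.NumberTheory.GaloisRepresentations.HeckeCharacter.toIdeleClassCharacter (χ : HeckeCharacter K) : IdeleClassGroup K →ₜ* ℂˣ where
  toMonoidHom := QuotientGroup.lift (GaloisRepresentations.principalIdeles K) χ.toContinuousMonoidHom.toMonoidHom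
    fun _ hx => χ.map_principal hx
  continuous_toFun :=
    (QuotientGroup.isQuotientMap_mk (GaloisRepresentations.principalIdeles K)).continuous_iff.mpr
      χ.toContinuousMonoidHom.continuous

/-- The descended character evaluated at the class of an idele. [folklore] -/
@[simp]
theorem _root_.Literature.NumberTheory.GaloisRepresentations.HeckeCharacter.toIdeleClassCharacter_mk (χ : HeckeCharacter K) (x : GaloisRepresentations.ideleGroup K) :
    χ.toIdeleClassCharacter (x : IdeleClassGroup K) = χ x := rfl

/-- Pulling back a continuous quasi-character of `C_K` to `𝕀_K` gives a Hecke character. [folklore] -/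
def _root_.Literature.NumberTheory.GaloisRepresentations.HeckeCharacter.ofIdeleClassCharacter (ψ : IdeleClassGroup K →ₜ* ℂˣ) : HeckeCharacter K where
  toContinuousMonoidHom := ψ.comp (IdeleClassGroup.mk K)
  map_principal' x hx := by
    change ψ (x : IdeleClassGroup K) = 1
    rw [(QuotientGroup.eq_one_iff x).mpr hx, map_one]

/-- The pulled-back Hecke character evaluated at an idele. [folklore] -/
@[simp]
theorem _root_.Literature.NumberTheory.GaloisRepresentations.HeckeCharacter.ofIdeleClassCharacter_apply (ψ : IdeleClassGroup K →ₜ* ℂˣ) (x : GaloisRepresentations.ideleGroup K) :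
    ofIdeleClassCharacter ψ x = ψ (x : IdeleClassGroup K) := rfl

variable (K) in
/-- **Hecke characters are the continuous quasi-characters of the idele class group**:
`HeckeCharacter K ≃ (C_K →ₜ* ℂˣ)` (reconciliation of G09's idelic definition with `C_K`).
Ref: Cassels–Fröhlich, Ch. XV (Tate) §4.1; Weil, *Basic Number Theory*, Ch. VII §3. [folklore] -/
def _root_.Literature.NumberTheory.GaloisRepresentations.HeckeCharacter.equivIdeleClassCharacter : HeckeCharacter K ≃ (IdeleClassGroup K →ₜ* ℂˣ) where
  toFun := toIdeleClassCharacter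
  invFun := ofIdeleClassCharacter
  left_inv χ := HeckeCharacter.ext fun _ => rfl
  right_inv ψ := by
    refine ContinuousMonoidHom.ext fun c => ?_
    induction c using QuotientGroup.induction_on with
    | H x => rfl

/-- The bijection is multiplicative. [folklore] -/
theorem _root_.Literature.NumberTheory.GaloisRepresentations.HeckeCharacter.equivIdeleClassCharacter_mul (χ ψ : HeckeCharacter K) :
    equivIdeleClassCharacter K (χ * ψ) =
      equivIdeleClassCharacter K χ * equivIdeleClassCharacter K ψ := by
  refine ContinuousMonoidHom.ext fun c => ?_
  induction c using QuotientGroup.induction_on with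
  | H x => rfl

end HeckeCharacter
end Literature.NumberTheory.Automorphic
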